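import Summits.QuantumAdvantage.AdviceFreeQNC0.RelativeElimination
import Summits.QuantumAdvantage.AdviceFreeQNC0.ShiftedProducts
import HarnessLib

/-!
# Cell qa-qnc0 (rung F-Q1, route RingFrame, crux α): JOINT elimination against the residues of two
# blocks

`jointElimHard` — there is `η₁ > 0` such that for every `C`, all large `L, L'`, every four
polynomials `a₀, b₀, a₁, b₁ ∈ lowDeg 𝔽₂ (L + L') ((log₂ min(L,L'))^C)` and decoders `dec₀, dec₁`:
on at least `η₁·2^{L+L'}` inputs `w = (x, z)` BOTH `dec₀(a₀ w, b₀ w) ≡ |x|` and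
`dec₁(a₁ w, b₁ w) ≡ |z| (mod 3)` — a polylog-degree device cannot avoid naming its own JOINT
residue cell of two blocks.  Proof: fibrewise `elimHard` on the first block gives the first event
on `≥ η₀·2^{L+L'}` inputs; by Markov `≥ (η₀/2)·2^L` rows `x` carry `≥ (η₀/2)·2^{L'}` of it; in
such a row the event is a union of `≤ 4` level sets of `(a₀, b₀)(x, ·)`, one of density
`≥ η₀/10`, on which `elimHard_relative` (file `RelativeElimination.lean`) for `(a₁, b₁)(x, ·)`
gives the second event.  Also: restrictions to a block keep the degree
(`comp_append_left/right_mem_lowDeg`), fibrewise counts over a block, and the degree budget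
`(log₂ n)^C ≤ c₀√n` eventually.

The cell's statement (prover, toward the "one interior window" case of crux α, whose unknowns are
the residues of a prefix and a suffix block); not in print.  WHAT THIS IS NOT: no claim on ring
strategies with interior clusters yet (the parity/decoder layer is the next file); nothing on
`LDMAPolylog`, `TRPlus` or α; no separation.

## References

* S. Srinivasan, *A robust version of Hegedűs's lemma, with applications*, TheoretiCS 2 (2023),
  Lemma 3.1 [Srinivasan2023].
* S. Jukna, *Boolean Function Complexity*, Springer (2012), §2.1 [JuknaBFC2012].
-/

noncomputable section

namespace Summit.QuantumAdvantage.AdviceFreeQNC0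

open Finset
open Literature.Computability.MetaComplexity Literature.Computability.MetaComplexity.Smolensky
open Literature.Computability.MetaComplexity.Hegedus

/-- Over `𝔽₂`: `x + α + 1 ≠ 0 ↔ x = α`. [folklore] -/
private theorem zmod2_add_add_one_ne_zero_iff'' (x α : ZMod 2) : x + α + 1 ≠ 0 ↔ x = α := by
  revert x α; decide

/-! ### Two blocks: restrictions and fibre counts -/

variable {L L' : ℕ}

/-- Restriction to the first block (second block fixed) keeps the degree.
[cite: JuknaBFC2012, §2.1] -/
theorem comp_append_left_mem_lowDeg {D : ℕ} {P : CubeFn (ZMod 2) (L + L')}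
    (hP : P ∈ lowDeg (ZMod 2) (L + L') D) (z : Fin L' → Bool) :
    (fun x : Fin L → Bool => P (Fin.append x z)) ∈ lowDeg (ZMod 2) L D := by
  refine comp_subst_mem_lowDeg (fun x : Fin L → Bool => Fin.append x z) (fun i => ?_) hP
  induction i using Fin.addCases with
  | left j => exact Or.inr ⟨j, fun x => by simp [Fin.append_left]⟩
  | right j => exact Or.inl ⟨z j, fun x => by simp [Fin.append_right]⟩

/-- Restriction to the second block (first block fixed) keeps the degree.
[cite: JuknaBFC2012, §2.1] -/
theorem comp_append_right_mem_lowDeg {D : ℕ} {P : CubeFn (ZMod 2) (L + L')}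
    (hP : P ∈ lowDeg (ZMod 2) (L + L') D) (x : Fin L → Bool) :
    (fun z : Fin L' → Bool => P (Fin.append x z)) ∈ lowDeg (ZMod 2) L' D := by
  refine comp_subst_mem_lowDeg (fun z : Fin L' → Bool => Fin.append x z) (fun i => ?_) hP
  induction i using Fin.addCases with
  | left j => exact Or.inl ⟨x j, fun z => by simp [Fin.append_left]⟩
  | right j => exact Or.inr ⟨j, fun z => by simp [Fin.append_right]⟩

/-- The first block of `x ++ z` is `x`. [folklore] -/
theorem left_of_append (x : Fin L → Bool) (z : Fin L' → Bool) :
    (fun i : Fin L => Fin.append x z (Fin.castAdd L' i)) = x := by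
  funext i; simp [Fin.append_left]

/-- The second block of `x ++ z` is `z`. [folklore] -/
theorem right_of_append (x : Fin L → Bool) (z : Fin L' → Bool) :
    (fun j : Fin L' => Fin.append x z (Fin.natAdd L j)) = z := by
  funext j; simp [Fin.append_right]

/-- Counting a predicate on the `(L + L')`-cube through the pairs `(x, z)`. [folklore] -/
theorem card_filter_eq_card_pairs (P : (Fin (L + L') → Bool) → Prop) [DecidablePred P] :
    (univ.filter P).card =
      ((univ : Finset ((Fin L → Bool) × (Fin L' → Bool))).filter
        fun p => P (Fin.append p.1 p.2)).card := by
  refine Finset.card_bij' (fun w _ => (fun i => w (Fin.castAdd L' i), fun j => w (Fin.natAdd L j)))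
    (fun p _ => Fin.append p.1 p.2) ?_ ?_ ?_ ?_
  · intro w hw
    rw [mem_filter] at hw ⊢
    refine ⟨mem_univ _, ?_⟩
    rw [Fin.append_castAdd_natAdd]
    exact hw.2
  · intro p hp
    rw [mem_filter] at hp ⊢
    exact ⟨mem_univ _, hp.2⟩
  · intro w _
    exact Fin.append_castAdd_natAdd
  · intro p _
    exact Prod.ext (left_of_append p.1 p.2) (right_of_append p.1 p.2)

/-- Fibrewise count over the first block. [folklore] -/
theorem card_filter_eq_sum_left (P : (Fin (L + L') → Bool) → Prop) [DecidablePred P] :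
    (univ.filter P).card = ∑ x : Fin L → Bool,
      (univ.filter fun z : Fin L' → Bool => P (Fin.append x z)).card := by
  classical
  rw [card_filter_eq_card_pairs P, card_eq_sum_card_fibre_fst]
  refine Finset.sum_congr rfl fun x _ => ?_
  refine card_fibre_fst_eq _ x _ fun z => ?_
  simp only [mem_filter, mem_univ, true_and]

/-- Fibrewise count over the second block. [folklore] -/
theorem card_filter_eq_sum_right (P : (Fin (L + L') → Bool) → Prop) [DecidablePred P] :
    (univ.filter P).card = ∑ z : Fin L' → Bool,
      (univ.filter fun x : Fin L → Bool => P (Fin.append x z)).card := by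
  classical
  rw [card_filter_eq_card_pairs P, card_eq_sum_card_fibre_snd]
  refine Finset.sum_congr rfl fun z _ => ?_
  refine card_fibre_snd_eq _ z _ fun x => ?_
  simp only [mem_filter, mem_univ, true_and]

/-- `(log₂ n)^C ≤ c₀ √n` for `n ≥ n₀(C, c₀)` (re-derivation of the cell lemma `logPow_le_sqrt`).
[folklore] -/
theorem logPow_le_sqrt' (C : ℕ) {c₀ : ℝ} (hc₀ : 0 < c₀) :
    ∃ n₀ : ℕ, ∀ n : ℕ, n₀ ≤ n → ((Nat.log 2 n ^ C : ℕ) : ℝ) ≤ c₀ * Real.sqrt n := by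
  have hr : (1 : ℝ) < Real.sqrt 2 := by
    rw [show (1 : ℝ) = Real.sqrt 1 by simp]
    exact Real.sqrt_lt_sqrt (by norm_num) (by norm_num)
  have ht := tendsto_pow_const_div_const_pow_of_one_lt C hr
  obtain ⟨K₀, hK₀⟩ := Filter.eventually_atTop.1 (ht.eventually_le_const hc₀)
  refine ⟨2 ^ K₀, fun n hn => ?_⟩
  have hn0 : n ≠ 0 := by
    have : 0 < 2 ^ K₀ := Nat.pos_of_ne_zero (by positivity)
    omega
  set k := Nat.log 2 n with hk_def
  have hk : K₀ ≤ k := Nat.le_log_of_pow_le one_lt_two hn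
  have h2k : (2 : ℝ) ^ k ≤ n := by exact_mod_cast Nat.pow_log_le_self 2 hn0
  have hs_pos : 0 < Real.sqrt 2 ^ k := pow_pos (by positivity) k
  have hsq2 : (Real.sqrt 2 ^ k) ^ 2 = (2 : ℝ) ^ k := by
    rw [← pow_mul, mul_comm, pow_mul, Real.sq_sqrt (by norm_num : (0 : ℝ) ≤ 2)]
  have hle : Real.sqrt 2 ^ k ≤ Real.sqrt n := Real.le_sqrt_of_sq_le (by rw [hsq2]; exact h2k)
  have hK := hK₀ k hk
  rw [div_le_iff₀ hs_pos] at hK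
  push_cast
  calc (k : ℝ) ^ C ≤ c₀ * Real.sqrt 2 ^ k := hK
    _ ≤ c₀ * Real.sqrt n := by gcongr

/-! ### Joint elimination against the residues of two blocks -/

/-- **Joint elimination hardness (two blocks).**  There is `η₁ > 0` such that for every `C`, all
large `L, L'`, every `a₀, b₀, a₁, b₁ ∈ lowDeg 𝔽₂ (L + L') ((log₂ min(L, L'))^C)` and every pair
of decoders, on at least `η₁·2^{L+L'}` inputs `w = x ++ z` both `dec₀(a₀ w, b₀ w) ≡ |x|` and
`dec₁(a₁ w, b₁ w) ≡ |z| (mod 3)`.  (Cell statement: a polylog-degree device cannot avoid naming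
its own joint residue cell; fibrewise `elimHard` + Markov + `elimHard_relative`.)
[cite: Srinivasan2023, Lemma 3.1] -/
theorem jointElimHard :
    ∃ η₁ : ℝ, 0 < η₁ ∧ ∀ C : ℕ, ∃ L₀ : ℕ, ∀ L L' : ℕ, L₀ ≤ L → L₀ ≤ L' →
      ∀ a₀ b₀ a₁ b₁ : CubeFn (ZMod 2) (L + L'),
        a₀ ∈ lowDeg (ZMod 2) (L + L') ((Nat.log 2 (min L L')) ^ C) →
        b₀ ∈ lowDeg (ZMod 2) (L + L') ((Nat.log 2 (min L L')) ^ C) →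
        a₁ ∈ lowDeg (ZMod 2) (L + L') ((Nat.log 2 (min L L')) ^ C) →
        b₁ ∈ lowDeg (ZMod 2) (L + L') ((Nat.log 2 (min L L')) ^ C) →
          ∀ dec₀ dec₁ : ZMod 2 → ZMod 2 → ℕ,
            η₁ * (2 : ℝ) ^ (L + L') ≤ ((univ.filter fun w : Fin (L + L') → Bool =>
              dec₀ (a₀ w) (b₀ w) % 3 = wt (fun i : Fin L => w (Fin.castAdd L' i)) % 3 ∧
              dec₁ (a₁ w) (b₁ w) % 3 = wt (fun j : Fin L' => w (Fin.natAdd L j)) % 3).card : ℝ) := by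
  classical
  obtain ⟨η₀, hη₀, hE⟩ := elimHard
  obtain ⟨η', hη', c₀, hc₀, n₁, hR⟩ := elimHard_relative (η₀ / 10) (by positivity)
  refine ⟨η₀ / 2 * η', by positivity, fun C => ?_⟩
  obtain ⟨n₀, hn₀⟩ := hE C
  obtain ⟨n₂, hn₂⟩ := logPow_le_sqrt' C (c₀ := c₀ / 2) (by positivity)
  refine ⟨max (max n₀ n₁) n₂, fun L L' hL hL' a₀ b₀ a₁ b₁ ha₀ hb₀ ha₁ hb₁ dec₀ dec₁ => ?_⟩
  have hLn₀ : n₀ ≤ L := le_trans (le_trans (le_max_left _ _) (le_max_left _ _)) hL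
  have hL'n₁ : n₁ ≤ L' := le_trans (le_trans (le_max_right _ _) (le_max_left _ _)) hL'
  have hL'n₂ : n₂ ≤ L' := le_trans (le_max_right _ _) hL'
  set D := (Nat.log 2 (min L L')) ^ C with hD
  have hDL : D ≤ (Nat.log 2 L) ^ C := Nat.pow_le_pow_left (Nat.log_mono_right (min_le_left _ _)) C
  have hDL' : D ≤ (Nat.log 2 L') ^ C := Nat.pow_le_pow_left (Nat.log_mono_right (min_le_right _ _)) C
  -- degree budget on the second block: `3D ≤ c₀ √L'`... we need `2D ≤ c₀ √L'`
  have hdeg2 : ((D + D : ℕ) : ℝ) ≤ c₀ * Real.sqrt L' := by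
    have h1 : ((Nat.log 2 L' ^ C : ℕ) : ℝ) ≤ c₀ / 2 * Real.sqrt L' := hn₂ L' hL'n₂
    have h2 : (D : ℝ) ≤ ((Nat.log 2 L' ^ C : ℕ) : ℝ) := by exact_mod_cast hDL'
    push_cast
    linarith
  -- the two events
  let E₀ : (Fin (L + L') → Bool) → Prop := fun w =>
    dec₀ (a₀ w) (b₀ w) % 3 = wt (fun i : Fin L => w (Fin.castAdd L' i)) % 3
  let E₁ : (Fin (L + L') → Bool) → Prop := fun w =>
    dec₁ (a₁ w) (b₁ w) % 3 = wt (fun j : Fin L' => w (Fin.natAdd L j)) % 3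
  -- row counts of the first event
  let A : (Fin L → Bool) → ℕ := fun x =>
    (univ.filter fun z : Fin L' → Bool => E₀ (Fin.append x z)).card
  -- (1) fibrewise `elimHard` on the first block: `Σ_x A x ≥ η₀ 2^{L+L'}`
  have hstep1 : η₀ * (2 : ℝ) ^ (L + L') ≤ ((∑ x : Fin L → Bool, A x : ℕ) : ℝ) := by
    have hcols : ∀ z : Fin L' → Bool, η₀ * (2 : ℝ) ^ L ≤
        ((univ.filter fun x : Fin L → Bool => E₀ (Fin.append x z)).card : ℝ) := by
      intro z
      have h := hn₀ L hLn₀ (fun x => a₀ (Fin.append x z)) (fun x => b₀ (Fin.append x z))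
        (lowDeg_mono hDL (comp_append_left_mem_lowDeg ha₀ z))
        (lowDeg_mono hDL (comp_append_left_mem_lowDeg hb₀ z)) dec₀
      have hset : (univ.filter fun x : Fin L → Bool =>
          dec₀ (a₀ (Fin.append x z)) (b₀ (Fin.append x z)) % 3 = wt x % 3) =
          univ.filter fun x : Fin L → Bool => E₀ (Fin.append x z) := by
        refine filter_congr fun x _ => ?_
        simp only [E₀, left_of_append]
      rw [hset] at h
      exact h
    have htot : ((univ.filter E₀).card : ℝ) = ((∑ x : Fin L → Bool, A x : ℕ) : ℝ) := by
      rw [card_filter_eq_sum_left E₀]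
    have htot' : ((univ.filter E₀).card : ℝ) =
        ∑ z : Fin L' → Bool, ((univ.filter fun x : Fin L → Bool => E₀ (Fin.append x z)).card : ℝ) := by
      rw [card_filter_eq_sum_right E₀]; push_cast; rfl
    rw [← htot, htot']
    calc η₀ * (2 : ℝ) ^ (L + L') = ∑ _z : Fin L' → Bool, η₀ * (2 : ℝ) ^ L := by
          rw [sum_const, card_univ, Fintype.card_fun, Fintype.card_bool, Fintype.card_fin,
            nsmul_eq_mul, pow_add]
          push_cast; ring
      _ ≤ _ := sum_le_sum fun z _ => hcols z
  -- (2) Markov: many rows carry `≥ (η₀/2) 2^{L'}`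
  set G := (univ : Finset (Fin L → Bool)).filter fun x => η₀ / 2 * (2 : ℝ) ^ L' ≤ (A x : ℝ) with hG
  have hstep2 : η₀ / 2 * (2 : ℝ) ^ L ≤ (G.card : ℝ) := by
    have hAle : ∀ x, (A x : ℝ) ≤ (2 : ℝ) ^ L' := by
      intro x
      have : A x ≤ (univ : Finset (Fin L' → Bool)).card := card_le_card (filter_subset _ _)
      rw [card_univ, Fintype.card_fun, Fintype.card_bool, Fintype.card_fin] at this
      exact_mod_cast this
    have hsplit : ((∑ x : Fin L → Bool, A x : ℕ) : ℝ) =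
        ∑ x ∈ G, (A x : ℝ) + ∑ x ∈ univ.filter (fun x => ¬ η₀ / 2 * (2 : ℝ) ^ L' ≤ (A x : ℝ)),
          (A x : ℝ) := by
      push_cast
      rw [hG, ← sum_filter_add_sum_filter_not univ (fun x => η₀ / 2 * (2 : ℝ) ^ L' ≤ (A x : ℝ))]
    have h1 : ∑ x ∈ G, (A x : ℝ) ≤ (G.card : ℝ) * (2 : ℝ) ^ L' := by
      calc ∑ x ∈ G, (A x : ℝ) ≤ ∑ _x ∈ G, (2 : ℝ) ^ L' := sum_le_sum fun x _ => hAle x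
        _ = (G.card : ℝ) * (2 : ℝ) ^ L' := by rw [sum_const, nsmul_eq_mul]
    have h2 : ∑ x ∈ univ.filter (fun x => ¬ η₀ / 2 * (2 : ℝ) ^ L' ≤ (A x : ℝ)), (A x : ℝ) ≤
        (2 : ℝ) ^ L * (η₀ / 2 * (2 : ℝ) ^ L') := by
      calc ∑ x ∈ univ.filter (fun x => ¬ η₀ / 2 * (2 : ℝ) ^ L' ≤ (A x : ℝ)), (A x : ℝ)
          ≤ ∑ _x ∈ univ.filter (fun x => ¬ η₀ / 2 * (2 : ℝ) ^ L' ≤ (A x : ℝ)),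
              η₀ / 2 * (2 : ℝ) ^ L' := by
            refine sum_le_sum fun x hx => ?_
            rw [mem_filter] at hx
            exact le_of_lt (not_le.1 hx.2)
        _ = ((univ.filter (fun x => ¬ η₀ / 2 * (2 : ℝ) ^ L' ≤ (A x : ℝ))).card : ℝ) *
              (η₀ / 2 * (2 : ℝ) ^ L') := by rw [sum_const, nsmul_eq_mul]
        _ ≤ (2 : ℝ) ^ L * (η₀ / 2 * (2 : ℝ) ^ L') := by
            have hc : ((univ.filter (fun x => ¬ η₀ / 2 * (2 : ℝ) ^ L' ≤ (A x : ℝ))).card : ℝ) ≤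
                (2 : ℝ) ^ L := by
              have : (univ.filter (fun x => ¬ η₀ / 2 * (2 : ℝ) ^ L' ≤ (A x : ℝ))).card ≤
                  (univ : Finset (Fin L → Bool)).card := card_le_card (filter_subset _ _)
              rw [card_univ, Fintype.card_fun, Fintype.card_bool, Fintype.card_fin] at this
              exact_mod_cast this
            have hpos : (0 : ℝ) ≤ η₀ / 2 * (2 : ℝ) ^ L' := by positivity
            exact mul_le_mul_of_nonneg_right hc hpos
    have hpow : (2 : ℝ) ^ (L + L') = (2 : ℝ) ^ L * (2 : ℝ) ^ L' := pow_add _ _ _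
    have h2L' : (0 : ℝ) < (2 : ℝ) ^ L' := by positivity
    have key : η₀ / 2 * (2 : ℝ) ^ L * (2 : ℝ) ^ L' ≤ (G.card : ℝ) * (2 : ℝ) ^ L' := by
      have := hstep1; rw [hsplit, hpow] at this; nlinarith
    exact le_of_mul_le_mul_right key h2L'
  -- (3) in a good row, a dense level set of `(a₀, b₀)(x, ·)` inside the first event, on which the
  --     relative elimination bound for `(a₁, b₁)(x, ·)` gives the second event
  have hstep3 : ∀ x ∈ G, η' * (2 : ℝ) ^ L' ≤
      ((univ.filter fun z : Fin L' → Bool => E₀ (Fin.append x z) ∧ E₁ (Fin.append x z)).card : ℝ) := by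
    intro x hx
    rw [hG, mem_filter] at hx
    have hAx := hx.2
    -- the first event in row `x` is a union of level sets of `(a₀, b₀)(x, ·)`
    set r := wt x % 3 with hr
    have hAeq : A x = ∑ p ∈ (univ : Finset (ZMod 2 × ZMod 2)).filter (fun p => dec₀ p.1 p.2 % 3 = r),
        (univ.filter fun z : Fin L' → Bool =>
          a₀ (Fin.append x z) = p.1 ∧ b₀ (Fin.append x z) = p.2).card := by
      have h := card_eq_sum_card_fiberwise
        (s := univ.filter fun z : Fin L' → Bool => E₀ (Fin.append x z))
        (t := (univ : Finset (ZMod 2 × ZMod 2)).filter fun p => dec₀ p.1 p.2 % 3 = r)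
        (f := fun z => (a₀ (Fin.append x z), b₀ (Fin.append x z))) (fun z hz => by
          rw [Finset.mem_coe, mem_filter] at hz
          rw [Finset.mem_coe, mem_filter]
          refine ⟨mem_univ _, ?_⟩
          have := hz.2
          simp only [E₀, left_of_append] at this
          exact this)
      change (univ.filter fun z : Fin L' → Bool => E₀ (Fin.append x z)).card = _
      rw [h]
      refine sum_congr rfl fun p hp => ?_
      rw [mem_filter] at hp
      congr 1
      ext z
      simp only [mem_filter, mem_univ, true_and, Prod.ext_iff, E₀, left_of_append]
      constructor
      · rintro ⟨-, h1, h2⟩; exact ⟨h1, h2⟩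
      · rintro ⟨h1, h2⟩; refine ⟨?_, h1, h2⟩; rw [h1, h2]; exact hp.2
    -- one of the (at most four) level sets is `η₀/10`-dense
    have hbig : ∃ p : ZMod 2 × ZMod 2, dec₀ p.1 p.2 % 3 = r ∧ η₀ / 10 * (2 : ℝ) ^ L' ≤
        ((univ.filter fun z : Fin L' → Bool =>
          a₀ (Fin.append x z) = p.1 ∧ b₀ (Fin.append x z) = p.2).card : ℝ) := by
      by_contra hno
      push Not at hno
      have hle : (A x : ℝ) ≤ ∑ _p ∈ (univ : Finset (ZMod 2 × ZMod 2)).filter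
          (fun p => dec₀ p.1 p.2 % 3 = r), η₀ / 10 * (2 : ℝ) ^ L' := by
        rw [hAeq]; push_cast
        exact sum_le_sum fun p hp => le_of_lt (hno p (mem_filter.1 hp).2)
      rw [sum_const, nsmul_eq_mul] at hle
      have hc4 : (((univ : Finset (ZMod 2 × ZMod 2)).filter (fun p => dec₀ p.1 p.2 % 3 = r)).card : ℝ)
          ≤ 4 := by
        have : ((univ : Finset (ZMod 2 × ZMod 2)).filter (fun p => dec₀ p.1 p.2 % 3 = r)).card ≤
            (univ : Finset (ZMod 2 × ZMod 2)).card := card_le_card (filter_subset _ _)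
        have h4 : (univ : Finset (ZMod 2 × ZMod 2)).card = 4 := by simp
        rw [h4] at this; exact_mod_cast this
      have hmul : (((univ : Finset (ZMod 2 × ZMod 2)).filter (fun p => dec₀ p.1 p.2 % 3 = r)).card : ℝ)
          * (η₀ / 10 * (2 : ℝ) ^ L') ≤ 4 * (η₀ / 10 * (2 : ℝ) ^ L') :=
        mul_le_mul_of_nonneg_right hc4 (by positivity)
      have hpos : (0 : ℝ) < η₀ * (2 : ℝ) ^ L' := by positivity
      linarith
    obtain ⟨⟨α, β⟩, hpr, hdense⟩ := hbig
    -- relative elimination on that level set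
    set v : CubeFn (ZMod 2) L' := (fun z => a₀ (Fin.append x z)) + (fun _ => α + 1) with hv
    set v' : CubeFn (ZMod 2) L' := (fun z => b₀ (Fin.append x z)) + (fun _ => β + 1) with hv'
    have hconst : ∀ c : ZMod 2, (fun _ : Fin L' → Bool => c) ∈ lowDeg (ZMod 2) L' D := by
      intro c
      have h1 : (1 : CubeFn (ZMod 2) L') ∈ lowDeg (ZMod 2) L' D := by
        rw [← mono_empty]; exact mono_mem_lowDeg (by simp)
      have : (fun _ : Fin L' → Bool => c) = c • (1 : CubeFn (ZMod 2) L') := by funext u; simp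
      rw [this]; exact Submodule.smul_mem _ c h1
    have hvv : v * v' ∈ lowDeg (ZMod 2) L' (D + D) :=
      mul_mem_lowDeg_add (Submodule.add_mem _ (comp_append_right_mem_lowDeg ha₀ x) (hconst _))
        (Submodule.add_mem _ (comp_append_right_mem_lowDeg hb₀ x) (hconst _))
    have hvv_iff : ∀ z, (v * v') z ≠ 0 ↔ a₀ (Fin.append x z) = α ∧ b₀ (Fin.append x z) = β := by
      intro z
      simp only [hv, hv', Pi.mul_apply, Pi.add_apply, mul_ne_zero_iff]
      rw [← add_assoc, ← add_assoc, zmod2_add_add_one_ne_zero_iff'', zmod2_add_add_one_ne_zero_iff'']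
    have ha₁x : (fun z => a₁ (Fin.append x z)) ∈ lowDeg (ZMod 2) L' (D + D) :=
      lowDeg_mono (by omega) (comp_append_right_mem_lowDeg ha₁ x)
    have hb₁x : (fun z => b₁ (Fin.append x z)) ∈ lowDeg (ZMod 2) L' (D + D) :=
      lowDeg_mono (by omega) (comp_append_right_mem_lowDeg hb₁ x)
    have hsuppv : (univ.filter fun z : Fin L' → Bool => (v * v') z ≠ 0) =
        univ.filter fun z : Fin L' → Bool => a₀ (Fin.append x z) = α ∧ b₀ (Fin.append x z) = β :=
      filter_congr fun z _ => hvv_iff z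
    have hrel := hR L' hL'n₁ (D + D) hdeg2 (v * v') _ _ hvv ha₁x hb₁x dec₁ (by rw [hsuppv]; exact hdense)
    refine hrel.trans ?_
    have hsub : (univ.filter fun z : Fin L' → Bool => (v * v') z ≠ 0 ∧
        dec₁ (a₁ (Fin.append x z)) (b₁ (Fin.append x z)) % 3 = wt z % 3) ⊆
        univ.filter fun z : Fin L' → Bool => E₀ (Fin.append x z) ∧ E₁ (Fin.append x z) := by
      intro z hz
      rw [mem_filter] at hz ⊢
      obtain ⟨hα, hβ⟩ := (hvv_iff z).1 hz.2.1
      refine ⟨mem_univ _, ?_, ?_⟩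
      · simp only [E₀, left_of_append]; rw [hα, hβ]; exact hpr
      · simp only [E₁, right_of_append]; exact hz.2.2
    exact_mod_cast card_le_card hsub
  -- (4) sum over the good rows
  have htot : ((univ.filter fun w : Fin (L + L') → Bool => E₀ w ∧ E₁ w).card : ℝ) =
      ∑ x : Fin L → Bool,
        ((univ.filter fun z : Fin L' → Bool => E₀ (Fin.append x z) ∧ E₁ (Fin.append x z)).card : ℝ) := by
    rw [card_filter_eq_sum_left (fun w => E₀ w ∧ E₁ w)]; push_cast; rfl
  change η₀ / 2 * η' * (2 : ℝ) ^ (L + L') ≤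
    ((univ.filter fun w : Fin (L + L') → Bool => E₀ w ∧ E₁ w).card : ℝ)
  rw [htot]
  calc η₀ / 2 * η' * (2 : ℝ) ^ (L + L') = (η₀ / 2 * (2 : ℝ) ^ L) * (η' * (2 : ℝ) ^ L') := by
        rw [pow_add]; ring
    _ ≤ (G.card : ℝ) * (η' * (2 : ℝ) ^ L') :=
        mul_le_mul_of_nonneg_right hstep2 (by positivity)
    _ = ∑ _x ∈ G, η' * (2 : ℝ) ^ L' := by rw [sum_const, nsmul_eq_mul]
    _ ≤ ∑ x ∈ G, ((univ.filter fun z : Fin L' → Bool =>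
          E₀ (Fin.append x z) ∧ E₁ (Fin.append x z)).card : ℝ) := sum_le_sum hstep3
    _ ≤ ∑ x : Fin L → Bool, ((univ.filter fun z : Fin L' → Bool =>
          E₀ (Fin.append x z) ∧ E₁ (Fin.append x z)).card : ℝ) :=
        sum_le_sum_of_subset_of_nonneg (filter_subset _ _) fun _ _ _ => by positivity

end Summit.QuantumAdvantage.AdviceFreeQNC0
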